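import Literature.MathematicalPhysics.QuantumFieldTheory.Balaban1983to89.B4Thm19ZeroTorus
import Literature.MathematicalPhysics.QuantumFieldTheory.Balaban1983to89.B4Thm110ZeroTorusLevel

/-!
# B4 «Theorem (Proposition 2.1 of [1])», the Hölder clause (1.9) at `A = 0` on the torus — AT EVERY LEVEL `k` IN THE PRINT'S OWN
# UNITS `η = L^{−k}`: weight `(L^k/|x₁−x₂|_T)^α`, rate `e^{−δ₀D/L^k}`, `T_η` prefactor `L^kε`

statement-level skeleton of published theorems with citation tags; proofs where landed; nothing here is a claim about the
Yang–Mills mass gap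

B4 = T. Bałaban, *Regularity and decay of lattice Green's functions*, Commun. Math. Phys. **89** (1983) 571–597
[cite: Balaban1983RegularityDecay] (journal page = PDF page + 570; held `paper:balaban1983-cmp89-regularity-decay`, pp. 572–573
[PDF 2–3] and p. 582 [PDF 12] re-read by this seat); B1 = *(Higgs)₂,₃ quantum fields in a finite volume I*, Commun. Math. Phys. **85**
(1982) 603–636 [cite: Balaban1982Higgs1].  Cell `lit-balaban`, B4 fold owner r01 (gen 14); companion of p38's `B4Thm19ZeroTorus`
(imported, untouched) and sequel of `B4Thm110ZeroTorusLevel` ((1.10) in level-`k` units), answering the units note of the C2 fold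
owner r18 (gen 19, 2026-08-22) for the Hölder member as well (consumer: p31's `BIJ88NeumannPropagatorFlatDecay.holder19_flat`).

## WHAT IS PRINTED (verbatim; `≦` written `≤`)

* p. 572 [PDF 2]: «We consider operators on subsets of the lattice ηZ^d, η = L^{−k}. … The lattice ηZ^d is divided into unit cubes
  called blocks …»; «Another common case is to consider operators on subsets of a torus T_η …».
* p. 573 [PDF 3]: «**Theorem** (Proposition 2.1 of [1]). For α < 1 there exist positive constants δ₀, c₀, R₀ independent of A,
  k, Ω and depending on d, M only, c₀ on α also, such that for e sufficiently small and for an arbitrary function f : Ω → R^N,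
  we have (1/|x − x′|^α)|U(A(Γ_{x,x′}))(D^η_{A,μ}G_k(Ω, A)f)(x′) − (D^η_{A,μ}G_k(Ω, A)f)(x)| ≤ c₀exp(−δ₀ dist({x, x′}, supp f))‖f‖_∞
  (1.9) for x, x′ ∈ Ω, and satisfying the condition dist({x, x′}, Ω^c) ≥ R₀. … For some simple sets Ω, e.g. for rectangular
  parallelepipeds, the inequalities hold without any restrictions on the points x, x′, i.e. for all x, x′ ∈ Ω.»
* p. 582 [PDF 12]: (2.38)–(2.39) — «We use (2.34) with j-th term rescaled to the L^{−j}-lattice … Σ_j a_j²(L^jη)^{1−α}(L^jη/|x−x′|)^α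
  … ≤ Σ_{j=1}^{k−1} a_j²(L^jη)^{1−α}c₁O(1)‖f‖_∞ + η^{1−α}4c₀O(1)‖f‖_∞ ≤ O(1)Σ_{j=0}^{k−1}(L^jη)^{1−α}‖f‖_∞ ≤ c′₁‖f‖_∞ (2.39)».

## THE UNITS (as in `B4Thm110ZeroTorusLevel`)

In the print `η = L^{−k}` and the `k`-blocks are unit cubes, so in (1.9) both `|x − x′|` and `dist({x,x′}, supp f)` are fine lattice
distances DIVIDED BY `L^k`, with `δ₀, c₀` `k`-uniform in these units.  For Bałaban's scalar torus tower (`ε = L^{−K}`, `G^ε_k =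
(L^kε)²G_k^{resc}`, `∂^ε = (L^kε)^{−1}D^η`, `G_k^{resc} = B5Display136Torus.Grs P a m² k =` B4's `G_k(T_η, 0)`) the printed (1.9) reads
`(L^k/|x₁−x₂|_T)^α·|(∂^ε_μG^ε_kf)(x₂) − (∂^ε_μG^ε_kf)(x₁)| ≤ c₀(L^kε)e^{−δ₀D/L^k}‖f‖_∞`, equivalently
`(η|x₁−x₂|_T)^{−α}|(D^η_μG_k^{resc}f)(x₂) − (D^η_μG_k^{resc}f)(x₁)| ≤ c₀e^{−δ₀·ηD}‖f‖_∞`.  p38's `thm19_zero_torus` has the weight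
`(ε|x₁−x₂|_T)^{−α}` and the rate `e^{−δ₀εD}` — the printed statement at the top level `k = K` (all that `B4ThmZeroTorusEta.torusEtaFam`
uses), not at `k < K`.  NO OBSTRUCTION along p38's route (2.38)–(2.39): the term `j` is `a²c_H(L^jε)^{1−α}e^{−(δ/4)D/L^j}` after the
two-point row sum (`B4Thm19ZeroTorus.term_row_bound_pair`, `deltaK1_pair_bound`, `weight_near_eq`), and `e^{−(δ/4)D/L^j} ≤ e^{−(δ/4)D/L^k}`,
`Σ_{1≤j<k}(L^jε)^{1−α} ≤ (L^kε)^{1−α}/(L^{1−α} − 1)`; the `j = 0` rows carry `(ε|x₁−x₂|_T)^{−α}·ε ≤ ε^{1−α} ≤ (L^kε)^{1−α}` and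
`e^{−(δ₀/2)D} ≤ e^{−(δ₀/2)D/L^k}`.  Constants: p38's, verbatim.

## WHAT THIS FILE CERTIFIES (kernel-checked, zero `sorry`, theorems only)

* §1 `spacing_eq_mul_rpow` (`L^jε = L^kε·L^{j−k}`), **`sum_spacing_rpow_le_level`** (`Σ_{1≤j<k}(L^jε)^{1−α} ≤ (L^kε)^{1−α}/(L^{1−α}−1)`,
  `α < 1`), `weight_zero_le_level` (`(ε|x₁−x₂|_T)^{−α}·ε ≤ (L^kε)^{1−α}`), `weight_level_eq` (`(L^k/ρ₀)^α = (L^kε)^α(ερ₀)^{−α}`),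
  `derivGrs_mulVec` (`(D^η_μG_k^{resc}f)(x) = (L^kε)^{−1}(∂^ε_μG^ε_kf)(x)`).
* §2 **`holder_row_bound_level`** — (1.9) at one volume from p38's kernel hypotheses (`KerBounds`, `hG0`, the Hölder bound (2.36) `hH`),
  `1 ≤ k ≤ m + K`, `0 ≤ α < 1`: `(ε|x₁−x₂|_T)^{−α}|(∂^ε_μG^ε_kf)(x₂) − (∂^ε_μG^ε_kf)(x₁)| ≤ (4C₀e^{δ₀}K_d(δ₀/2) +
  a²c_H/(L^{1−α}−1))·(L^kε)^{1−α}·e^{−min(δ₀/2,δ/4)·D/L^k}·F` — p38's `holder_row_bound` with the factor `(L^kε)^{1−α}` gained and the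
  rate in level-`k` units (no `k ≤ K` needed).
* §3 **`thm19_zero_torus_level`** — (1.9) ON THE TORUS AT `A = 0`, HYPOTHESIS-FREE, UNIFORM IN THE VOLUME AND IN `1 ≤ k ≤ K`, `0 ≤ α < 1`,
  IN THE PRINT'S UNITS: `δ₀ > 0` before `α`, `c₀(α) > 0`, and
  `(L^k/|x₁−x₂|_T)^α·|(∂^ε_μG^ε_kf)(x₂) − (∂^ε_μG^ε_kf)(x₁)| ≤ c₀(L^kε)e^{−δ₀D/L^k}F` (p38's quantifier shape; the weight is the one of
  the box member `B4Thm19ZeroBoxHolder`/p31's `holder19_flat_cube`); **`thm19_zero_torus_resc`** — VERBATIM (1.9) for B4's own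
  `G_k(T_η,0) = Grs` and `D^η_μ = deriv P 0 (ε/(L^kε)) μ`: `(η|x₁−x₂|_T)^{−α}|(D^η_μG_k^{resc}f)(x₂) − (D^η_μG_k^{resc}f)(x₁)| ≤
  c₀e^{−δ₀D/L^k}F`.  p38's form follows from §3 by `(L^kε)^{1−α} ≤ 1`, `e^{−δ₀D/L^k} ≤ e^{−δ₀εD}` (not restated).

## DICTIONARY / HONEST SCOPE

As in `B4Thm19ZeroTorus` (i)–(vi): `A = 0` (`U(A(Γ)) = 1`), one component, `Ω = Ω₀ = T_η` (no `R₀`); sup torus metric in fine units,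
`|x − x′| ↦ |x₁−x₂|_T/L^k = η|x₁−x₂|_T`, `dist({x,x′}, supp f) ↦ D/L^k` for any `0 ≤ D ≤ |x_i − z|_T` on `supp f` (Euclidean vs sup:
a change of `c₀`, `δ₀` by `d`-dependent factors); **`0 ≤ α < 1` only** (`B4Thm19ZeroBoxNegAlpha`); `δ₀` before `α`, `c₀` on `α`; the
tower's level-`k` mass `(L^kε)²m² ≤ m²` under a fixed cap; constants existential; route = the print's (2.38)–(2.39) on the torus.
NOT CERTIFIED here: background fields, general regions `Ω`, a re-packaged `B4.EtaSetting` torus family indexed by `(volume, k)`.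
-/

namespace Literature.MathematicalPhysics.QuantumFieldTheory.Balaban1983to89

namespace B4Thm19ZeroTorusLevel

open Matrix B1RG242Torus B5Display136Torus B5Leaf237C0Torus B4Ineq115Torus B5Ineq137Torus B4Ineq116Torus
  B4Thm110ZeroTorus B4Thm19ZeroTorus B4Thm110ZeroTorusLevel

/-! ## §1 Scale and weight bookkeeping in level-`k` units -/

section Scales

variable (P : Params)

/-- `L^jε = L^kε·L^{j−k}` (real power). [cite: Balaban1983RegularityDecay, (2.39) p.582 (the factors «(L^jη)^{1−α}», η = L^{−k});
scale bookkeeping] -/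
theorem spacing_eq_mul_rpow (j k : ℕ) : P.spacing j = P.spacing k * (P.L : ℝ) ^ ((j : ℝ) - k) := by
  have hL : (0 : ℝ) < P.L := P.cast_L_pos
  have hLk : (P.L : ℝ) ^ (k : ℝ) ≠ 0 := (Real.rpow_pos_of_pos hL _).ne'
  rw [Real.rpow_sub hL, Real.rpow_natCast, Real.rpow_natCast]
  unfold Params.spacing
  field_simp

/-- `s·(s⁻¹)^α = s^{1−α}` for `s > 0`. [folklore] -/
private theorem mul_inv_rpow_eq' {s α : ℝ} (hs : 0 < s) : s * (s⁻¹) ^ α = s ^ (1 - α) := by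
  rw [Real.inv_rpow hs.le, ← Real.rpow_neg hs.le, Real.rpow_sub hs, Real.rpow_one, Real.rpow_neg hs.le, div_eq_mul_inv]

/-- **THE SCALE SUM OF (2.39) UP TO THE LEVEL `k`**: `Σ_{1 ≤ j < k}(L^jε)^{1−α} ≤ (L^kε)^{1−α}/(L^{1−α} − 1)` for `α < 1` (every `k`;
`B5FromB4.scale_sum_bound` after factoring `(L^kε)^{1−α}`) — the printed «O(1)Σ_{j=0}^{k−1}(L^jη)^{1−α} ≤ c′₁» in units where the
`k`-blocks are unit cubes. [cite: Balaban1983RegularityDecay, (2.39) p.582] -/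
theorem sum_spacing_rpow_le_level (k : ℕ) {α : ℝ} (hα1 : α < 1) :
    ∑ j ∈ Finset.Ico 1 k, P.spacing j ^ (1 - α)
      ≤ P.spacing k ^ (1 - α) * (1 / ((P.L : ℝ) ^ (1 - α) - 1)) := by
  have hL1 : (1 : ℝ) < P.L := one_lt_cast_L P
  have hL : (0 : ℝ) < P.L := P.cast_L_pos
  have hsk : 0 ≤ P.spacing k := (P.spacing_pos k).le
  have hsub : Finset.Ico 1 k ⊆ Finset.range k := fun j hj => Finset.mem_range.mpr (Finset.mem_Ico.mp hj).2
  have hterm : ∀ j, P.spacing j ^ (1 - α) = P.spacing k ^ (1 - α) * ((P.L : ℝ) ^ ((j : ℝ) - k)) ^ (1 - α) := by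
    intro j
    rw [spacing_eq_mul_rpow P j k, Real.mul_rpow hsk (Real.rpow_pos_of_pos hL _).le]
  calc ∑ j ∈ Finset.Ico 1 k, P.spacing j ^ (1 - α)
      ≤ ∑ j ∈ Finset.range k, P.spacing j ^ (1 - α) :=
        Finset.sum_le_sum_of_subset_of_nonneg hsub fun j _ _ => Real.rpow_nonneg (P.spacing_pos j).le _
    _ = P.spacing k ^ (1 - α) * ∑ j ∈ Finset.range k, ((P.L : ℝ) ^ ((j : ℝ) - k)) ^ (1 - α) := by
        rw [Finset.mul_sum]; exact Finset.sum_congr rfl fun j _ => hterm j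
    _ ≤ P.spacing k ^ (1 - α) * (1 / ((P.L : ℝ) ^ (1 - α) - 1)) :=
        mul_le_mul_of_nonneg_left (B5FromB4.scale_sum_bound _ _ hL1 (by linarith) k)
          (Real.rpow_nonneg hsk _)

/-- THE `j = 0` WEIGHT IN LEVEL-`k` UNITS: `(ε|x₁−x₂|_T)^{−α}·ε ≤ ε^{1−α} ≤ (L^kε)^{1−α}` for distinct fine sites (`|x₁−x₂|_T ≥ 1`,
`0 ≤ α < 1`, `ε ≤ L^kε`) — the printed `η^{1−α}` of (2.39) against the level-`k` scale. [cite: Balaban1983RegularityDecay, (2.39) p.582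
(«η^{1−α}4c₀O(1)‖f‖_∞»)] -/
theorem weight_zero_le_level (k : ℕ) {ρ₀ α : ℝ} (hρ : 1 ≤ ρ₀) (hα0 : 0 ≤ α) (hα1 : α < 1) :
    ((P.eps * ρ₀)⁻¹) ^ α * P.eps ≤ P.spacing k ^ (1 - α) := by
  have hε0 : 0 < P.eps := P.eps_pos
  have hρ0 : 0 < ρ₀ := lt_of_lt_of_le one_pos hρ
  have h1 : ((P.eps * ρ₀)⁻¹) ^ α ≤ (P.eps⁻¹) ^ α := by
    refine Real.rpow_le_rpow (by positivity) ?_ hα0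
    rw [mul_inv]
    exact mul_le_of_le_one_right (by positivity) (inv_le_one_of_one_le₀ hρ)
  calc ((P.eps * ρ₀)⁻¹) ^ α * P.eps ≤ (P.eps⁻¹) ^ α * P.eps := mul_le_mul_of_nonneg_right h1 hε0.le
    _ = P.eps ^ (1 - α) := by rw [mul_comm]; exact mul_inv_rpow_eq' hε0
    _ ≤ P.spacing k ^ (1 - α) := Real.rpow_le_rpow hε0.le (eps_le_spacing P k) (by linarith)

/-- THE LEVEL-`k` WEIGHT AGAINST THE `ε`-WEIGHT: `(L^k/ρ₀)^α = (L^kε)^α·((ερ₀)^{−1})^α` (`ρ₀ > 0`): the print's `|x−x′|^{−α}` with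
`η = L^{−k}` versus p38's with `η = ε`. [cite: Balaban1983RegularityDecay, (1.9) p.573 with η = L^{−k} p.572; scale bookkeeping] -/
theorem weight_level_eq (k : ℕ) {ρ₀ α : ℝ} (hρ : 0 < ρ₀) :
    ((P.L : ℝ) ^ k / ρ₀) ^ α = P.spacing k ^ α * ((P.eps * ρ₀)⁻¹) ^ α := by
  have hε0 : 0 < P.eps := P.eps_pos
  have hsk : 0 < P.spacing k := P.spacing_pos k
  rw [← Real.mul_rpow hsk.le (by positivity)]
  congr 1
  unfold Params.spacing
  field_simp

/-- THE DIFFERENCE DERIVATIVE IN THE PRINT'S UNITS: `(D^η_μG_k^{resc}f)(x) = (L^kε)^{−1}·(∂^ε_μG^ε_kf)(x)` with `η = ε/(L^kε) = L^{−k}`,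
`D^η_μ = B1RG242Torus.deriv P 0 (ε/(L^kε)) μ`, `G^ε_k = (L^kε)²G_k^{resc}` (`B5Display136Torus.G_eq_smul_Grs`).
[cite: Balaban1983RegularityDecay, (1.6) and η = L^{−k} p.572, p.573 (difference derivative); Balaban1982Higgs1, (2.30)–(2.31) p.611
(the rescaling); dictionary] -/
theorem derivGrs_mulVec {a msq : ℝ} (ha : 0 < a) (hm : 0 ≤ msq) {k : ℕ} (hk1 : 1 ≤ k) (μ : Fin P.d)
    (f : Site P 0 → ℝ) (x : Site P 0) :
    ((deriv P 0 (P.eps / P.spacing k) μ * Grs P a msq k) *ᵥ f) x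
      = (P.spacing k)⁻¹ * ((deriv P 0 P.eps μ * (tower P a msq).G k) *ᵥ f) x := by
  have hs : P.spacing k ≠ 0 := (P.spacing_pos k).ne'
  have hε : P.eps ≠ 0 := P.eps_pos.ne'
  have hGrs : Grs P a msq k = (P.spacing k ^ 2)⁻¹ • (tower P a msq).G k := by
    rw [G_eq_smul_Grs (P := P) ha hm hk1, inv_smul_smul₀ (pow_ne_zero 2 hs)]
  rw [← mulVec_mulVec, deriv_mulVec, ← mulVec_mulVec, deriv_mulVec, hGrs, smul_mulVec, Pi.smul_apply,
    Pi.smul_apply, smul_eq_mul, smul_eq_mul]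
  field_simp

/-- Distinct sites of a torus of the tower are at sup distance `≥ 1` (the distance is a natural number). [folklore] -/
private theorem one_le_T_of_ne' {i : ℕ} {x x' : Site P i} (h : x' ≠ x) : 1 ≤ T P i x x' := by
  have hT : T P i x x' ≠ 0 := fun h0 => h (eq_of_T_eq_zero (P := P) h0).symm
  unfold T B4Sect5Torus.tdist at hT ⊢
  have hn : (Finset.univ.sup (B4Sect5Torus.ccoord (Nv P i) (toT x) (toT x')) : ℕ) ≠ 0 := by exact_mod_cast hT
  exact_mod_cast Nat.one_le_iff_ne_zero.mpr hn

end Scales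

/-! ## §2 The Hölder clause (1.9) at one volume from the kernel bounds, in level-`k` units -/

section Rows

variable (P : Params)

/-- **(1.9) ON THE TORUS FROM THE KERNEL BOUNDS, LEVEL-`k` UNITS** (one volume, `1 ≤ k ≤ m + K`, `0 ≤ α < 1`): under p38's
hypotheses of `B4Thm19ZeroTorus.holder_row_bound` ((2.35), (2.37) at rate `δ` with constant `C`: `KerBounds`; the `C^{(0)}` kernel: `hG0`;
the Hölder bound (2.36) with constant `c₁` at rate `δ`: `hH`), for distinct fine sites `x₁ ≠ x₂`, every direction `μ` and every
source `f` (`|f| ≤ F`) vanishing within fine distance `D ≥ 0` of both points,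
`(ε|x₁−x₂|_T)^{−α}|(∂^ε_μG^ε_kf)(x₂) − (∂^ε_μG^ε_kf)(x₁)| ≤ (4C₀e^{δ₀}K_d(δ₀/2) + a²c_H/(L^{1−α}−1))·(L^kε)^{1−α}·e^{−min(δ₀/2,δ/4)·D/L^k}·F`,
`c_H = 2c₁e^{δ}C²K_d(δ/2)²e^{δ/2}K_d(δ/4)` — the printed (2.38)–(2.39) with the `j`-th term `a²c_H(L^jε)^{1−α}e^{−(δ/4)D/L^j}F`, the
rate kept at the level-`k` scale and the scale sum taken up to `k` (`sum_spacing_rpow_le_level`), the `j = 0` rows by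
`weight_zero_le_level`. [cite: Balaban1983RegularityDecay, Theorem (1.9) p.573 (η = L^{−k} p.572), (2.38)–(2.39) p.582, Lemma 2.4 (2.36)
p.582, p.584 («valid for an arbitrary rectangular parallelepiped»), p.572 (torus)] -/
theorem holder_row_bound_level {a msq : ℝ} (ha : 0 < a) (hm : 0 ≤ msq) {k : ℕ} (hk1 : 1 ≤ k)
    (hkm : k ≤ P.m + P.K) {C δ C₀ δ₀ c₁ α : ℝ} (hC : 0 ≤ C) (hδ : 0 < δ) (hC₀ : 0 ≤ C₀) (hδ₀ : 0 < δ₀)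
    (hc₁ : 0 ≤ c₁) (hα0 : 0 ≤ α) (hα1 : α < 1) (hK : KerBounds P a msq k C δ)
    (hG0 : ∀ x x' : Site P 0, |G0unit P a msq x x'| ≤ C₀ * Real.exp (-(δ₀ * T P 0 x x')))
    (μ : Fin P.d) {x₁ x₂ : Site P 0} (hne : x₂ ≠ x₁)
    (hH : ∀ j : ℕ, 1 ≤ j → j < k → ∀ y : Site P j, ((P.L : ℝ) ^ j / T P 0 x₁ x₂) ^ α *
        |K1 P a msq j μ x₂ ⟨j, y⟩ - K1 P a msq j μ x₁ ⟨j, y⟩|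
          ≤ c₁ * Real.exp (-(δ * min (dXU P j x₁ ⟨j, y⟩) (dXU P j x₂ ⟨j, y⟩))))
    (f : Site P 0 → ℝ) {F D : ℝ} (hF : ∀ z, |f z| ≤ F) (hD0 : 0 ≤ D)
    (hD₁ : ∀ z, f z ≠ 0 → D ≤ T P 0 x₁ z) (hD₂ : ∀ z, f z ≠ 0 → D ≤ T P 0 x₂ z) :
    ((P.eps * T P 0 x₁ x₂)⁻¹) ^ α *
        |((deriv P 0 P.eps μ * (tower P a msq).G k) *ᵥ f) x₂ -
          ((deriv P 0 P.eps μ * (tower P a msq).G k) *ᵥ f) x₁|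
      ≤ (4 * C₀ * Real.exp δ₀ * B4Sect5Proof.latticeConst P.d (δ₀ / 2) +
          a ^ 2 * (2 * c₁ * Real.exp δ * (C ^ 2 * B4Sect5Proof.latticeConst P.d (δ / 2) ^ 2 *
            (Real.exp (δ / 2) * B4Sect5Proof.latticeConst P.d (δ / 4)))) * (1 / ((P.L : ℝ) ^ (1 - α) - 1))) *
          P.spacing k ^ (1 - α) * Real.exp (-(min (δ₀ / 2) (δ / 4) * (D / (P.L : ℝ) ^ k))) * F := by
  have hL1 : (1 : ℝ) < P.L := one_lt_cast_L P
  have hε0 : 0 < P.eps := P.eps_pos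
  have hF0 : 0 ≤ F := (abs_nonneg _).trans (hF x₁)
  have hLk : 0 < (P.L : ℝ) ^ k := pow_pos P.cast_L_pos k
  have hDk : 0 ≤ D / (P.L : ℝ) ^ k := div_nonneg hD0 hLk.le
  have hρ1 : 1 ≤ T P 0 x₁ x₂ := one_le_T_of_ne' P hne
  have hρ0 : 0 < T P 0 x₁ x₂ := lt_of_lt_of_le one_pos hρ1
  set ρ₀ := T P 0 x₁ x₂ with hρ₀
  set w := ((P.eps * ρ₀)⁻¹) ^ α with hw
  have hw0 : 0 ≤ w := Real.rpow_nonneg (by positivity) α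
  set m₀ := min (δ₀ / 2) (δ / 4) with hm₀
  have hm₀0 : 0 ≤ m₀ := le_min (by positivity) (by positivity)
  set E := Real.exp (-(m₀ * (D / (P.L : ℝ) ^ k))) with hEdef
  have hE0 : 0 ≤ E := (Real.exp_pos _).le
  set sα := P.spacing k ^ (1 - α) with hsα
  have hsα0 : 0 ≤ sα := Real.rpow_nonneg (P.spacing_pos k).le _
  set X := C ^ 2 * B4Sect5Proof.latticeConst P.d (δ / 2) ^ 2 *
    (Real.exp (δ / 2) * B4Sect5Proof.latticeConst P.d (δ / 4)) with hX
  have hX0 : 0 ≤ X := by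
    have h1 := B4Sect5Proof.latticeConst_nonneg P.d (show 0 ≤ δ / 2 by positivity)
    have h2 := B4Sect5Proof.latticeConst_nonneg P.d (show 0 ≤ δ / 4 by positivity)
    positivity
  have hexp0 : Real.exp (-(δ₀ / 2 * D)) ≤ E := by
    refine (exp_fine_le_level P k (show 0 ≤ δ₀ / 2 by positivity) hD0).trans ?_
    rw [hEdef]
    exact Real.exp_le_exp.mpr (by nlinarith [mul_le_mul_of_nonneg_right (min_le_left (δ₀ / 2) (δ / 4)) hDk])
  -- the j = 0 rows: `η^{1−α}·4c₀O(1)‖f‖_∞` with `(ερ₀)^{−α}ε ≤ (L^kε)^{1−α}`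
  have h0 : w * |P.eps * (∑ x', (deriv P 0 1 μ * G0unit P a msq) x₂ x' * f x' -
        ∑ x', (deriv P 0 1 μ * G0unit P a msq) x₁ x' * f x')|
      ≤ 4 * C₀ * Real.exp δ₀ * B4Sect5Proof.latticeConst P.d (δ₀ / 2) * sα * E * F := by
    have hr₂ := fine_deriv_row_le P hC₀ hδ₀ hG0 μ x₂ f hF hD₂
    have hr₁ := fine_deriv_row_le P hC₀ hδ₀ hG0 μ x₁ f hF hD₁
    have hwε : w * P.eps ≤ sα := weight_zero_le_level P k hρ1 hα0 hα1
    have hK0 := B4Sect5Proof.latticeConst_nonneg P.d (show 0 ≤ δ₀ / 2 by positivity)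
    have hB0 : 0 ≤ 2 * C₀ * Real.exp δ₀ * B4Sect5Proof.latticeConst P.d (δ₀ / 2) * Real.exp (-(δ₀ / 2 * D)) * F := by
      positivity
    rw [abs_mul, abs_of_nonneg hε0.le, ← mul_assoc]
    calc w * P.eps * |∑ x', (deriv P 0 1 μ * G0unit P a msq) x₂ x' * f x' -
          ∑ x', (deriv P 0 1 μ * G0unit P a msq) x₁ x' * f x'|
        ≤ sα * (|∑ x', (deriv P 0 1 μ * G0unit P a msq) x₂ x' * f x'| +
            |∑ x', (deriv P 0 1 μ * G0unit P a msq) x₁ x' * f x'|) :=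
          mul_le_mul hwε (abs_sub _ _) (abs_nonneg _) hsα0
      _ ≤ sα * (2 * (2 * C₀ * Real.exp δ₀ * B4Sect5Proof.latticeConst P.d (δ₀ / 2) * Real.exp (-(δ₀ / 2 * D)) * F)) :=
          mul_le_mul_of_nonneg_left (by linarith) hsα0
      _ ≤ sα * (2 * (2 * C₀ * Real.exp δ₀ * B4Sect5Proof.latticeConst P.d (δ₀ / 2) * E * F)) :=
          mul_le_mul_of_nonneg_left (mul_le_mul_of_nonneg_left (mul_le_mul_of_nonneg_right
            (mul_le_mul_of_nonneg_left hexp0 (by positivity)) hF0) zero_le_two) hsα0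
      _ = _ := by ring
  -- the terms j ≥ 1: `a_j²(L^jη)^{1−α}c₁O(1)‖f‖_∞` at the level-k rate
  have hj : ∀ j ∈ Finset.Ico 1 k,
      w * |B1.aSeq a P.L j ^ 2 * P.spacing j *
          ∑ x', (∑ y : Site P j, ∑ y' : Site P j,
            (K1 P a msq j μ x₂ ⟨j, y⟩ - K1 P a msq j μ x₁ ⟨j, y⟩) * Crs P a msq j y y' *
              (Qk P j * Grs P a msq j) y' x') * f x'|
        ≤ a ^ 2 * (2 * c₁ * Real.exp δ * X) * E * F * P.spacing j ^ (1 - α) := by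
    intro j hjm
    obtain ⟨hj1, hjk⟩ := Finset.mem_Ico.mp hjm
    have hjm' : j ≤ P.m + P.K := hjk.le.trans hkm
    have hLj : 0 < (P.L : ℝ) ^ j := pow_pos P.cast_L_pos j
    have hpair := deltaK1_pair_bound P hjm' hc₁ hδ.le μ hne (hH j hj1 hjk)
    have hCA : 0 ≤ (ρ₀ / (P.L : ℝ) ^ j) ^ α * c₁ * Real.exp δ :=
      mul_nonneg (mul_nonneg (Real.rpow_nonneg (div_nonneg hρ0.le hLj.le) α) hc₁) (Real.exp_pos _).le
    have ht := term_row_bound_pair P hC hδ hK hj1 hjk hkm x₁ x₂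
      (fun y => K1 P a msq j μ x₂ ⟨j, y⟩ - K1 P a msq j μ x₁ ⟨j, y⟩) hCA hpair f hF hD₁ hD₂
    have haj : B1.aSeq a P.L j ^ 2 ≤ a ^ 2 := by
      have := B5Leaf235Torus.abs_aSeq_le ha hL1 j
      rw [← sq_abs]; exact pow_le_pow_left₀ (abs_nonneg _) this 2
    have hs0 : 0 ≤ P.spacing j := (P.spacing_pos j).le
    have hexp : Real.exp (-(δ / 4 * (D / (P.L : ℝ) ^ j))) ≤ E := by
      refine (exp_level_mono P hjk.le (show 0 ≤ δ / 4 by positivity) hD0).trans ?_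
      rw [hEdef]
      exact Real.exp_le_exp.mpr (by nlinarith [mul_le_mul_of_nonneg_right (min_le_right (δ₀ / 2) (δ / 4)) hDk])
    have hwt : w * ((ρ₀ / (P.L : ℝ) ^ j) ^ α * P.spacing j) = P.spacing j ^ (1 - α) := weight_near_eq P hρ0
    rw [abs_mul, abs_of_nonneg (by positivity : 0 ≤ B1.aSeq a P.L j ^ 2 * P.spacing j)]
    calc w * (B1.aSeq a P.L j ^ 2 * P.spacing j *
          |∑ x', (∑ y : Site P j, ∑ y' : Site P j,
            (K1 P a msq j μ x₂ ⟨j, y⟩ - K1 P a msq j μ x₁ ⟨j, y⟩) * Crs P a msq j y y' *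
              (Qk P j * Grs P a msq j) y' x') * f x'|)
        ≤ w * (a ^ 2 * P.spacing j *
            (2 * ((ρ₀ / (P.L : ℝ) ^ j) ^ α * c₁ * Real.exp δ * X * E * F))) := by
          refine mul_le_mul_of_nonneg_left ?_ hw0
          refine mul_le_mul (mul_le_mul_of_nonneg_right haj hs0) (ht.trans ?_) (abs_nonneg _) (by positivity)
          exact mul_le_mul_of_nonneg_left (mul_le_mul_of_nonneg_right
            (mul_le_mul_of_nonneg_left hexp (mul_nonneg hCA hX0)) hF0) zero_le_two
      _ = a ^ 2 * (2 * c₁ * Real.exp δ * X) * E * F *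
            (w * ((ρ₀ / (P.L : ℝ) ^ j) ^ α * P.spacing j)) := by ring
      _ = _ := by rw [hwt]
  -- assemble (2.39) up to the level k
  rw [derivG_sub_eq P ha hm hk1 μ x₁ x₂ f]
  refine le_trans (mul_le_mul_of_nonneg_left
    ((abs_add_le _ _).trans (add_le_add le_rfl (Finset.abs_sum_le_sum_abs _ _))) hw0) ?_
  rw [mul_add, Finset.mul_sum]
  refine (add_le_add h0 (Finset.sum_le_sum hj)).trans ?_
  rw [← Finset.mul_sum]
  have hsum := sum_spacing_rpow_le_level P k hα1
  have hB : 0 ≤ a ^ 2 * (2 * c₁ * Real.exp δ * X) * E * F := by positivity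
  refine (add_le_add le_rfl (mul_le_mul_of_nonneg_left hsum hB)).trans (le_of_eq ?_)
  rw [hsα]
  ring

end Rows

/-! ## §3 (1.9) on the torus at `A = 0` in the print's units, uniformly in the volume and in the level -/

section Uniform

/-- **B4 THEOREM (1.9) ON THE TORUS AT `A = 0`, IN THE PRINT'S UNITS `η = L^{−k}` — THE HÖLDER CLAUSE, UNIFORMLY IN THE VOLUME AND IN
THE LEVEL, `0 ≤ α < 1`.**  For `d ≥ 1`, odd `L > 1`, `a > 0`, `m² ≥ 0` there is `δ₀ > 0` and, for every `0 ≤ α < 1`, a `c₀ = c₀(α) > 0`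
(functions of `d, L, a, m²` and `α` only: «independent of A, k, Ω … c₀ on α also»; p38's constants) such that for EVERY volume
`P = (d, L, m, K)` of Bałaban's scalar torus tower, every level `1 ≤ k ≤ K`, every direction `μ`, all fine sites `x₁ ≠ x₂` and every
source `f` with `|f| ≤ F` vanishing within fine sup-distance `D ≥ 0` of both `x₁` and `x₂`:
`(L^k/|x₁−x₂|_T)^α·|(∂^ε_μG^ε_kf)(x₂) − (∂^ε_μG^ε_kf)(x₁)| ≤ c₀(L^kε)e^{−δ₀D/L^k}F` — the printed
`|x−x′|^{−α}|U(A(Γ_{x,x′}))(D^η_{A,μ}G_kf)(x′) − (D^η_{A,μ}G_kf)(x)| ≤ c₀exp(−δ₀dist({x,x′}, supp f))‖f‖_∞` at `A = 0` (`U = 1`) for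
`G_k(T_η,0)`, `η = L^{−k}`, read on the tower through `∂^εG^ε_k = (L^kε)D^ηG_k^{resc}`, `|x−x′|_η = |x₁−x₂|_T/L^k`, `dist_η = D/L^k`, with
no restriction on `x, x′` («for rectangular parallelepipeds … for all x, x′»).  p38's `B4Thm19ZeroTorus.thm19_zero_torus` (weight
`(ε|x₁−x₂|_T)^{−α}`, rate `e^{−δ₀εD}`) is this statement at `k = K` only and follows from it at every `k ≤ K`.  ROUTE: p38's — (2.34),
(2.38)–(2.39) with Lemma 2.4 on the torus ((2.35), (2.37): `kerBounds_torus`; (2.36): `B4Lemma24TorusScales.holder236_torus`) and the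
`C^{(0)}` kernel — through `holder_row_bound_level`.  NOT COVERED: `α < 0` (false, `B4Thm19ZeroBoxNegAlpha`); `A ≠ 0`; general `Ω`.
[cite: Balaban1983RegularityDecay, Theorem (1.9) p.573, η = L^{−k} and the torus p.572, (2.34)–(2.39) p.582, p.584, Lemma 2.4 p.582;
Balaban1984PropagatorsI p.39 («with □ replaced by the whole torus»)] -/
theorem thm19_zero_torus_level (d L : ℕ) (hd : 1 ≤ d) (hL : Odd L ∧ 1 < L) {a : ℝ} (ha : 0 < a) {msq : ℝ}
    (hmsq : 0 ≤ msq) :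
    ∃ δ₀ : ℝ, 0 < δ₀ ∧ ∀ {α : ℝ}, 0 ≤ α → α < 1 → ∃ c₀ : ℝ, 0 < c₀ ∧ ∀ (P : Params), P.d = d → P.L = L →
      ∀ k : ℕ, 1 ≤ k → k ≤ P.K → ∀ (μ : Fin P.d) (x₁ x₂ : Site P 0), x₂ ≠ x₁ →
        ∀ (f : Site P 0 → ℝ) (F D : ℝ), (∀ z, |f z| ≤ F) → 0 ≤ D →
          (∀ z, f z ≠ 0 → D ≤ T P 0 x₁ z) → (∀ z, f z ≠ 0 → D ≤ T P 0 x₂ z) →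
            ((P.L : ℝ) ^ k / T P 0 x₁ x₂) ^ α *
                |((deriv P 0 P.eps μ * (tower P a msq).G k) *ᵥ f) x₂ -
                  ((deriv P 0 P.eps μ * (tower P a msq).G k) *ᵥ f) x₁|
              ≤ c₀ * P.spacing k * Real.exp (-(δ₀ * (D / (P.L : ℝ) ^ k))) * F := by
  obtain ⟨C, δK, hC, hδK, hK⟩ := kerBounds_torus d L hd hL ha msq
  obtain ⟨δH, hδH, hH⟩ := B4Lemma24TorusScales.holder236_torus d L hd hL ha msq
  obtain ⟨δ, hδK', hδH', hδ⟩ : ∃ δ : ℝ, δ ≤ δK ∧ δ ≤ δH ∧ 0 < δ :=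
    ⟨min δK δH, min_le_left _ _, min_le_right _ _, lt_min hδK hδH⟩
  -- the j = 0 constants depend on d, L, a, m² only; read them off any volume with these d, L
  obtain ⟨P₀, hP₀d, hP₀L⟩ : ∃ P₀ : Params, P₀.d = d ∧ P₀.L = L := ⟨⟨d, L, 0, 0, hd, hL⟩, rfl, rfl⟩
  set C₀ := 2 / gamma0 L a with hC₀def
  set δ₀ := dK0 d L a msq with hδ₀def
  have hC₀ : 0 ≤ C₀ := by
    rw [hC₀def, ← hP₀L]; exact (div_pos two_pos (gamma0_pos (P := P₀) ha)).le
  have hδ₀ : 0 < δ₀ := by rw [hδ₀def, ← hP₀d, ← hP₀L]; exact dK0_pos (P := P₀) ha hmsq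
  have hL1 : (1 : ℝ) < L := by exact_mod_cast hL.2
  refine ⟨min (δ₀ / 2) (δ / 4), lt_min (by positivity) (by positivity), fun {α} hα0 hα1 => ?_⟩
  obtain ⟨c₁, hc₁, hH1⟩ := hH hα0 hα1
  have hLα : 0 < (L : ℝ) ^ (1 - α) - 1 := by
    have := Real.one_lt_rpow hL1 (by linarith : (0 : ℝ) < 1 - α)
    linarith
  have h1 := B4Sect5Proof.latticeConst_nonneg d (show 0 ≤ δ₀ / 2 by positivity)
  have h2 := B4Sect5Proof.latticeConst_nonneg d (show 0 ≤ δ / 2 by positivity)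
  have h2' := B4Sect5Proof.latticeConst_nonneg d (show 0 ≤ δ / 4 by positivity)
  have hc₁' := hc₁.le
  have h3 : 0 ≤ 1 / ((L : ℝ) ^ (1 - α) - 1) := (div_pos one_pos hLα).le
  refine ⟨4 * C₀ * Real.exp δ₀ * B4Sect5Proof.latticeConst d (δ₀ / 2) +
      a ^ 2 * (2 * c₁ * Real.exp δ * (C ^ 2 * B4Sect5Proof.latticeConst d (δ / 2) ^ 2 *
        (Real.exp (δ / 2) * B4Sect5Proof.latticeConst d (δ / 4)))) * (1 / ((L : ℝ) ^ (1 - α) - 1)) + 1,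
    by positivity, ?_⟩
  intro P hPd hPL k hk1 hkK μ x₁ x₂ hne f F D hF hD0 hD₁ hD₂
  have hkm : k ≤ P.m + P.K := hkK.trans (Nat.le_add_left _ _)
  have hcap : ∀ j, j ≤ P.K → P.spacing j ^ 2 * msq ≤ msq := by
    intro j hjK
    have hs1 : P.spacing j ≤ 1 := by rw [← P.spacing_K]; exact spacing_le_spacing P hjK
    calc P.spacing j ^ 2 * msq ≤ 1 * msq :=
          mul_le_mul_of_nonneg_right (pow_le_one₀ (P.spacing_pos j).le hs1) hmsq
      _ = msq := one_mul _
  have hKB : KerBounds P a msq k C δ :=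
    KerBounds.mono P hC (hK P hPd hPL msq hmsq k hkm (hcap k hkK)) le_rfl hδK'
  have hHB : ∀ j : ℕ, 1 ≤ j → j < k → ∀ y : Site P j, ((P.L : ℝ) ^ j / T P 0 x₁ x₂) ^ α *
      |K1 P a msq j μ x₂ ⟨j, y⟩ - K1 P a msq j μ x₁ ⟨j, y⟩|
        ≤ c₁ * Real.exp (-(δ * min (dXU P j x₁ ⟨j, y⟩) (dXU P j x₂ ⟨j, y⟩))) := by
    intro j hj1 hjk y
    have h := hH1 P hPd hPL msq hmsq j hj1 (hjk.le.trans hkm) (hcap j (hjk.le.trans hkK)) μ x₁ x₂ hne y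
    have hM0 : 0 ≤ min (dXU P j x₁ ⟨j, y⟩) (dXU P j x₂ ⟨j, y⟩) :=
      le_min (dXU_nonneg P j x₁ _) (dXU_nonneg P j x₂ _)
    have := mul_le_mul_of_nonneg_right hδH' hM0
    exact h.trans (mul_le_mul_of_nonneg_left (Real.exp_le_exp.mpr (by linarith)) hc₁.le)
  subst hPd hPL
  have hG0 : ∀ x x' : Site P 0, |G0unit P a msq x x'| ≤ C₀ * Real.exp (-(δ₀ * T P 0 x x')) :=
    fun x x' => G0unit_decay (P := P) ha hmsq x x'
  have hF0 : 0 ≤ F := (abs_nonneg _).trans (hF x₁)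
  have hmain := holder_row_bound_level P ha hmsq hk1 hkm hC hδ hC₀ hδ₀ hc₁.le hα0 hα1 hKB hG0 μ hne hHB f hF hD0
    hD₁ hD₂
  -- pass from the ε-weight to the level-k weight: `(L^k/ρ₀)^α = (L^kε)^α·(ερ₀)^{−α}`, `(L^kε)^α(L^kε)^{1−α} = L^kε`
  have hρ0 : 0 < T P 0 x₁ x₂ := lt_of_lt_of_le one_pos (one_le_T_of_ne' P hne)
  have hsk : 0 < P.spacing k := P.spacing_pos k
  have hsplit : P.spacing k ^ α * P.spacing k ^ (1 - α) = P.spacing k := by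
    rw [← Real.rpow_add hsk, add_sub_cancel, Real.rpow_one]
  set cst := 4 * C₀ * Real.exp δ₀ * B4Sect5Proof.latticeConst P.d (δ₀ / 2) +
      a ^ 2 * (2 * c₁ * Real.exp δ * (C ^ 2 * B4Sect5Proof.latticeConst P.d (δ / 2) ^ 2 *
        (Real.exp (δ / 2) * B4Sect5Proof.latticeConst P.d (δ / 4)))) * (1 / ((P.L : ℝ) ^ (1 - α) - 1)) with hcst
  have hcst0 : 0 ≤ cst := by positivity
  have hEF : 0 ≤ Real.exp (-(min (δ₀ / 2) (δ / 4) * (D / (P.L : ℝ) ^ k))) * F := mul_nonneg (Real.exp_pos _).le hF0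
  rw [weight_level_eq P k hρ0, mul_assoc]
  calc P.spacing k ^ α * (((P.eps * T P 0 x₁ x₂)⁻¹) ^ α *
        |((deriv P 0 P.eps μ * (tower P a msq).G k) *ᵥ f) x₂ -
          ((deriv P 0 P.eps μ * (tower P a msq).G k) *ᵥ f) x₁|)
      ≤ P.spacing k ^ α * (cst * P.spacing k ^ (1 - α) *
          Real.exp (-(min (δ₀ / 2) (δ / 4) * (D / (P.L : ℝ) ^ k))) * F) :=
        mul_le_mul_of_nonneg_left hmain (Real.rpow_nonneg hsk.le α)
    _ = cst * (P.spacing k ^ α * P.spacing k ^ (1 - α)) *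
          (Real.exp (-(min (δ₀ / 2) (δ / 4) * (D / (P.L : ℝ) ^ k))) * F) := by ring
    _ = cst * P.spacing k * (Real.exp (-(min (δ₀ / 2) (δ / 4) * (D / (P.L : ℝ) ^ k))) * F) := by rw [hsplit]
    _ ≤ (cst + 1) * P.spacing k * (Real.exp (-(min (δ₀ / 2) (δ / 4) * (D / (P.L : ℝ) ^ k))) * F) :=
        mul_le_mul_of_nonneg_right (mul_le_mul_of_nonneg_right (by linarith) hsk.le) hEF
    _ = _ := by ring

/-- **(1.9) ON THE TORUS AT `A = 0`, VERBATIM, FOR B4's OWN OPERATOR `G_k(T_η, 0)` AND DIFFERENCE DERIVATIVE `D^η_μ`, `η = L^{−k}`.**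
With `G_k^{resc} = B5Display136Torus.Grs P a m² k` (`= G_k(T_η, 0)`), `D^η_μ = B1RG242Torus.deriv P 0 (ε/(L^kε)) μ` and the weight
`(η|x₁−x₂|_T)^{−α}`, `η = ε/(L^kε)`: for `d ≥ 1`, odd `L > 1`, `a > 0`, `m² ≥ 0` there is `δ₀ > 0` and for every `0 ≤ α < 1` a `c₀ > 0`
such that for every volume, every `1 ≤ k ≤ K`, `μ`, `x₁ ≠ x₂` and every `f` with `|f| ≤ F` vanishing within fine distance `D ≥ 0` of both
points: `(η|x₁−x₂|_T)^{−α}·|(D^η_μG_k^{resc}f)(x₂) − (D^η_μG_k^{resc}f)(x₁)| ≤ c₀e^{−δ₀D/L^k}F`, `D/L^k = ηD = dist_η({x₁,x₂}, supp f)` —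
«(1/|x−x′|^α)|U(A(Γ_{x,x′}))(D^η_{A,μ}G_k(Ω,A)f)(x′) − (D^η_{A,μ}G_k(Ω,A)f)(x)| ≤ c₀exp(−δ₀dist({x,x′}, supp f))‖f‖_∞ (1.9)» with «δ₀, c₀
… independent of A, k, Ω … c₀ on α also», at `Ω = T_η`, `A = 0`, no restriction on `x, x′`, `0 ≤ α < 1`.
[cite: Balaban1983RegularityDecay, Theorem (1.9) p.573, (1.6) and η = L^{−k} p.572, p.573 («for rectangular parallelepipeds … for all
x, x′»); Balaban1982Higgs1, (2.30)–(2.31) p.611 (the rescaling)] -/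
theorem thm19_zero_torus_resc (d L : ℕ) (hd : 1 ≤ d) (hL : Odd L ∧ 1 < L) {a : ℝ} (ha : 0 < a) {msq : ℝ}
    (hmsq : 0 ≤ msq) :
    ∃ δ₀ : ℝ, 0 < δ₀ ∧ ∀ {α : ℝ}, 0 ≤ α → α < 1 → ∃ c₀ : ℝ, 0 < c₀ ∧ ∀ (P : Params), P.d = d → P.L = L →
      ∀ k : ℕ, 1 ≤ k → k ≤ P.K → ∀ (μ : Fin P.d) (x₁ x₂ : Site P 0), x₂ ≠ x₁ →
        ∀ (f : Site P 0 → ℝ) (F D : ℝ), (∀ z, |f z| ≤ F) → 0 ≤ D →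
          (∀ z, f z ≠ 0 → D ≤ T P 0 x₁ z) → (∀ z, f z ≠ 0 → D ≤ T P 0 x₂ z) →
            ((P.eps / P.spacing k * T P 0 x₁ x₂)⁻¹) ^ α *
                |((deriv P 0 (P.eps / P.spacing k) μ * Grs P a msq k) *ᵥ f) x₂ -
                  ((deriv P 0 (P.eps / P.spacing k) μ * Grs P a msq k) *ᵥ f) x₁|
              ≤ c₀ * Real.exp (-(δ₀ * (D / (P.L : ℝ) ^ k))) * F := by
  obtain ⟨δ₀, hδ₀, H⟩ := thm19_zero_torus_level d L hd hL ha hmsq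
  refine ⟨δ₀, hδ₀, fun {α} hα0 hα1 => ?_⟩
  obtain ⟨c₀, hc₀, H1⟩ := H hα0 hα1
  refine ⟨c₀, hc₀, fun P hPd hPL k hk1 hkK μ x₁ x₂ hne f F D hF hD0 hD₁ hD₂ => ?_⟩
  have h := H1 P hPd hPL k hk1 hkK μ x₁ x₂ hne f F D hF hD0 hD₁ hD₂
  have hsk : 0 < P.spacing k := P.spacing_pos k
  have hε : 0 < P.eps := P.eps_pos
  -- the weight: `(ε/(L^kε))·ρ₀ = ρ₀/L^k`
  have hwt : (P.eps / P.spacing k * T P 0 x₁ x₂)⁻¹ = (P.L : ℝ) ^ k / T P 0 x₁ x₂ := by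
    unfold Params.spacing
    field_simp
  -- the derivative: `D^ηG^{resc} = (L^kε)^{−1}∂^εG^ε`
  rw [hwt, derivGrs_mulVec P ha hmsq hk1, derivGrs_mulVec P ha hmsq hk1, ← mul_sub, abs_mul,
    abs_of_nonneg (inv_pos.mpr hsk).le]
  calc ((P.L : ℝ) ^ k / T P 0 x₁ x₂) ^ α * ((P.spacing k)⁻¹ *
        |((deriv P 0 P.eps μ * (tower P a msq).G k) *ᵥ f) x₂ -
          ((deriv P 0 P.eps μ * (tower P a msq).G k) *ᵥ f) x₁|)
      = (P.spacing k)⁻¹ * (((P.L : ℝ) ^ k / T P 0 x₁ x₂) ^ α *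
        |((deriv P 0 P.eps μ * (tower P a msq).G k) *ᵥ f) x₂ -
          ((deriv P 0 P.eps μ * (tower P a msq).G k) *ᵥ f) x₁|) := by ring
    _ ≤ (P.spacing k)⁻¹ * (c₀ * P.spacing k * Real.exp (-(δ₀ * (D / (P.L : ℝ) ^ k))) * F) :=
        mul_le_mul_of_nonneg_left h (inv_pos.mpr hsk).le
    _ = _ := by field_simp

end Uniform

end B4Thm19ZeroTorusLevel

end Literature.MathematicalPhysics.QuantumFieldTheory.Balaban1983to89
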